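import Summits.HodgeConjecture.HodgeConjecture.Theorems.EightfoldBlochSeedsChernCharacterOnBettiAnalytificationFlag
import HarnessLib

/-!
# K1 → the CHERN CLASSES of vector bundles with a full flag are algebraic (all degrees)

Route `EightfoldBlochSeeds` / item `stmt-HodgeConjecture-19780` (`ChernCharacterOnBetti`), helper
(`--supports`). HONEST FRAMING: nothing here proves 19780 / 18880 / 18882 / 18883 / H2 / HC_AV / HC;
no definition, no named fact.

WHAT. Companion of `…AnalytificationFlag` (there: the Chern CHARACTER). On a smooth projective complex
variety `X`, for every `𝒪_X`-module `F` with a full flag (`Motives.HasFullFlag F`) and every topological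
analytification datum `(E, α)` of `F`:

  `cᵢ(E)_ℂ = theChernClassTheory.chernClassIn ℂ E i ∈ algebraicClasses X i = Nⁱ H²ⁱ(X(ℂ); ℂ)` for all `i`

(`chernClassIn_complex_mem_algebraicClasses_of_comparison_of_hasFullFlag`; Fulton Prop. 19.1.2 for
flagged bundles). Proof by induction on the flag with the Whitney formula for short exact sequences
(K1f, `chernClass_eq_sum_of_comparison_shortExact`, in `ℂ`-coefficients:
`chernClassIn_eq_sum_of_comparison_shortExact`): for `0 → F₁ → F → L → 0`,
`c_m(E) = c_m(E₁) + c_{m-1}(E₁) ⌣ c₁(E_L)` with `c₁(E_L)` a divisor class (K1c) and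
`Nᵐ⁻¹ ⌣ N¹ ⊆ Nᵐ` (Voisin 2025 §4.3, the tree's unconditional
`cupProduct_mem_supportedClasses_succ_of_mem_algebraicClasses_one_right`) —
`sum_cupEven_mem_algebraicClasses_of_rank_le_one`; the zero module has the Chern classes of the rank-`0`
datum (K1b, `chernClassIn_eq_of_comparison`).

[cite: Fulton1998, Thm. 3.2 (e) and Prop. 19.1.2] [cite: Grothendieck1958, §2]
[cite: Voisin2025, §4.1 Example 4.2 and §4.3] [cite: SerreGAGA1956, §3 n°9 Prop. 10]
-/

noncomputable section

-- single-problem summit (Problem = Summit): the mandated namespace repeats `HodgeConjecture`.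
set_option linter.dupNamespace false

open CategoryTheory AlgebraicGeometry Bundle Topology
open Literature.AlgebraicGeometry.Motives Literature.AlgebraicGeometry.HodgeTheory Literature.AlgebraicGeometry.Modules
open Literature.AlgebraicTopology.SingularHomology Literature.AlgebraicTopology.CharacteristicClasses

namespace Summit.HodgeConjecture.HodgeConjecture.Theorems

variable {n : ℕ} {X : SchemeOver ℂ}

/-- **`Σ_{i+j=m} aᵢ ⌣ bⱼ ∈ Nᵐ`** when every `aᵢ ∈ Nⁱ`, `b₀ = 1`, `b₁` is a divisor class and `bⱼ = 0`
for `j ≥ 2` (the total Chern class of a line bundle): the Whitney product with a line bundle preserves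
algebraicity (`Nᵐ⁻¹ ⌣ N¹ ⊆ Nᵐ`, Voisin 2025 §4.3). [cite: Voisin2025, §4.1 Example 4.2 and §4.3]
[cite: Fulton1998, Thm. 3.2 (e)] -/
theorem sum_cupEven_mem_algebraicClasses_of_rank_le_one (hX : IsSmoothProjective n X)
    {a b : (i : ℕ) → complexBetti X (2 * i)} (ha : ∀ i, a i ∈ algebraicClasses X i)
    (hb0 : b 0 = singularCohomology.one ℂ (ComplexPoints X)) (hb1 : b 1 ∈ algebraicClasses X 1)
    (hb : ∀ j, 2 ≤ j → b j = 0) (m : ℕ) :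
    (∑ ij : Finset.HasAntidiagonal.antidiagonal m,
      cupEven (Finset.HasAntidiagonal.mem_antidiagonal.mp ij.2) (a ij.1.1) (b ij.1.2)) ∈ algebraicClasses X m := by
  refine Submodule.sum_mem _ fun ij _ ↦ ?_
  obtain ⟨⟨i, j⟩, hij⟩ := ij
  have hij' : i + j = m := Finset.HasAntidiagonal.mem_antidiagonal.mp hij
  rcases j with _ | _ | j
  · -- `j = 0`: the term is `a m ⌣ 1 = a m`
    obtain rfl : i = m := by simpa using hij'
    have h1 : cupEven (Finset.HasAntidiagonal.mem_antidiagonal.mp hij) (a i) (b 0) = a i := by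
      rw [hb0]
      exact cupProduct_one (a i)
    rw [h1]
    exact ha i
  · -- `j = 1`: `a_{m-1} ⌣ b₁ ∈ Nᵐ`
    obtain rfl : m = i + 1 := by omega
    exact cupProduct_mem_supportedClasses_succ_of_mem_algebraicClasses_one_right hX _ (ha i) hb1
  · -- `j ≥ 2`: the term vanishes
    change cupEven _ (a i) (b (j + 2)) ∈ _
    rw [hb (j + 2) (by omega), map_zero]
    exact Submodule.zero_mem _

variable {S : ShortComplex X.left.Modules} {r₁ r₂ r₃ : ℕ}

/-- **Whitney for short exact sequences, analytified, `R`-coefficients**: `c_m(E₂)_R =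
Σ_{i+j=m} cᵢ(E₁)_R ⌣ cⱼ(E₃)_R` for data of the three terms of a short exact sequence of vector bundles
on a smooth projective `X` (K1f; change of coefficients is multiplicative).
[cite: HusemollerFibreBundles1994, Ch. 3 §9 Thm. 9.6 and Ch. 17 §3 (C₂)] [cite: SerreGAGA1956, §3 n°9 Prop. 10] -/
theorem chernClassIn_eq_sum_of_comparison_shortExact (hX : IsSmoothProjective n X) (R : Type) [CommRing R]
    (hS : S.ShortExact) (h₁ : IsFiniteLocallyFree S.X₁) (h₃ : IsFiniteLocallyFree S.X₃)
    (hF₁ : ∀ x : X.left, ∃ (U : X.left.Opens) (s : Fin r₁ → Γ(S.X₁, U)), x ∈ U ∧ IsSectionFrame S.X₁ U s)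
    (hF₂ : ∀ x : X.left, ∃ (U : X.left.Opens) (s : Fin r₂ → Γ(S.X₂, U)), x ∈ U ∧ IsSectionFrame S.X₂ U s)
    (hF₃ : ∀ x : X.left, ∃ (U : X.left.Opens) (s : Fin r₃ → Γ(S.X₃, U)), x ∈ U ∧ IsSectionFrame S.X₃ U s)
    (E₁ E₂ E₃ : ComplexVectorBundle.{0, 0} (ComplexPoints X))
    (α₁ : ∀ U : X.left.Opens, Γ(S.X₁, U) → ∀ P : ComplexPoints X, E₁.E P)
    (α₂ : ∀ U : X.left.Opens, Γ(S.X₂, U) → ∀ P : ComplexPoints X, E₂.E P)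
    (α₃ : ∀ U : X.left.Opens, Γ(S.X₃, U) → ∀ P : ComplexPoints X, E₃.E P)
    (hadd₁ : ∀ (U : X.left.Opens) (σ τ : Γ(S.X₁, U)) (P : ComplexPoints X), α₁ U (σ + τ) P = α₁ U σ P + α₁ U τ P)
    (hsmul₁ : ∀ (U : X.left.Opens) (f : Γ(X.left, U)) (σ : Γ(S.X₁, U)) (P : ComplexPoints X) (h : P.pt ∈ U),
      α₁ U (f • σ) P = P.eval U h f • α₁ U σ P)
    (hres₁ : ∀ (U W : X.left.Opens) (hWU : W ≤ U) (σ : Γ(S.X₁, U)) (P : ComplexPoints X), P.pt ∈ W →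
      α₁ W (S.X₁.presheaf.map (homOfLE hWU).op σ) P = α₁ U σ P)
    (hcont₁ : ∀ (U : X.left.Opens) (σ : Γ(S.X₁, U)),
      ContinuousOn (fun P ↦ (⟨P, α₁ U σ P⟩ : TotalSpace E₁.F E₁.E)) {P | P.pt ∈ U})
    (hframe₁ : ∀ (U : X.left.Opens) (t : Fin r₁ → Γ(S.X₁, U)), IsSectionFrame S.X₁ U t →
      ∀ P : ComplexPoints X, P.pt ∈ U → LinearIndependent ℂ (fun j ↦ α₁ U (t j) P) ∧
        ⊤ ≤ Submodule.span ℂ (Set.range fun j ↦ α₁ U (t j) P))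
    (hadd₂ : ∀ (U : X.left.Opens) (σ τ : Γ(S.X₂, U)) (P : ComplexPoints X), α₂ U (σ + τ) P = α₂ U σ P + α₂ U τ P)
    (hsmul₂ : ∀ (U : X.left.Opens) (f : Γ(X.left, U)) (σ : Γ(S.X₂, U)) (P : ComplexPoints X) (h : P.pt ∈ U),
      α₂ U (f • σ) P = P.eval U h f • α₂ U σ P)
    (hres₂ : ∀ (U W : X.left.Opens) (hWU : W ≤ U) (σ : Γ(S.X₂, U)) (P : ComplexPoints X), P.pt ∈ W →
      α₂ W (S.X₂.presheaf.map (homOfLE hWU).op σ) P = α₂ U σ P)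
    (hcont₂ : ∀ (U : X.left.Opens) (σ : Γ(S.X₂, U)),
      ContinuousOn (fun P ↦ (⟨P, α₂ U σ P⟩ : TotalSpace E₂.F E₂.E)) {P | P.pt ∈ U})
    (hframe₂ : ∀ (U : X.left.Opens) (t : Fin r₂ → Γ(S.X₂, U)), IsSectionFrame S.X₂ U t →
      ∀ P : ComplexPoints X, P.pt ∈ U → LinearIndependent ℂ (fun j ↦ α₂ U (t j) P) ∧
        ⊤ ≤ Submodule.span ℂ (Set.range fun j ↦ α₂ U (t j) P))
    (hadd₃ : ∀ (U : X.left.Opens) (σ τ : Γ(S.X₃, U)) (P : ComplexPoints X), α₃ U (σ + τ) P = α₃ U σ P + α₃ U τ P)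
    (hsmul₃ : ∀ (U : X.left.Opens) (f : Γ(X.left, U)) (σ : Γ(S.X₃, U)) (P : ComplexPoints X) (h : P.pt ∈ U),
      α₃ U (f • σ) P = P.eval U h f • α₃ U σ P)
    (hres₃ : ∀ (U W : X.left.Opens) (hWU : W ≤ U) (σ : Γ(S.X₃, U)) (P : ComplexPoints X), P.pt ∈ W →
      α₃ W (S.X₃.presheaf.map (homOfLE hWU).op σ) P = α₃ U σ P)
    (hcont₃ : ∀ (U : X.left.Opens) (σ : Γ(S.X₃, U)),
      ContinuousOn (fun P ↦ (⟨P, α₃ U σ P⟩ : TotalSpace E₃.F E₃.E)) {P | P.pt ∈ U})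
    (hframe₃ : ∀ (U : X.left.Opens) (t : Fin r₃ → Γ(S.X₃, U)), IsSectionFrame S.X₃ U t →
      ∀ P : ComplexPoints X, P.pt ∈ U → LinearIndependent ℂ (fun j ↦ α₃ U (t j) P) ∧
        ⊤ ≤ Submodule.span ℂ (Set.range fun j ↦ α₃ U (t j) P)) (m : ℕ) :
    theChernClassTheory.chernClassIn R E₂ m = ∑ ij : Finset.HasAntidiagonal.antidiagonal m,
      cupEven (Finset.HasAntidiagonal.mem_antidiagonal.mp ij.2) (theChernClassTheory.chernClassIn R E₁ ij.1.1)
        (theChernClassTheory.chernClassIn R E₃ ij.1.2) := by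
  have h := chernClass_eq_sum_of_comparison_shortExact hX hS h₁ h₃ hF₁ hF₂ hF₃ E₁ E₂ E₃ α₁ α₂ α₃ hadd₁ hsmul₁ hres₁
    hcont₁ hframe₁ hadd₂ hsmul₂ hres₂ hcont₂ hframe₂ hadd₃ hsmul₃ hres₃ hcont₃ hframe₃ m
  rw [ChernClassTheory.chernClassIn, h, map_sum]
  exact Finset.sum_congr rfl fun ij _ ↦ singularCohomology.ringChange_cupProduct _ _ _ _

variable {F : X.left.Modules} {r : ℕ}

/-- **The Chern classes of a module with a full flag are algebraic, in every degree** (Fulton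
Prop. 19.1.2 for flagged bundles): for `X` smooth projective over `ℂ`, `F` with `Motives.HasFullFlag F`
and ANY topological analytification datum `(E, α)` of `F`, `cᵢ(E)_ℂ ∈ algebraicClasses X i` for all `i`.
[cite: Fulton1998, Thm. 3.2 (e) and Prop. 19.1.2] [cite: Grothendieck1958, §2] [cite: Voisin2025, §4.3] -/
theorem chernClassIn_complex_mem_algebraicClasses_of_comparison_of_hasFullFlag (hX : IsSmoothProjective n X)
    (hflag : HasFullFlag F)
    (hF : ∀ x : X.left, ∃ (U : X.left.Opens) (s : Fin r → Γ(F, U)), x ∈ U ∧ IsSectionFrame F U s)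
    (E : ComplexVectorBundle.{0, 0} (ComplexPoints X))
    (α : ∀ U : X.left.Opens, Γ(F, U) → ∀ P : ComplexPoints X, E.E P)
    (hadd : ∀ (U : X.left.Opens) (σ τ : Γ(F, U)) (P : ComplexPoints X), α U (σ + τ) P = α U σ P + α U τ P)
    (hsmul : ∀ (U : X.left.Opens) (f : Γ(X.left, U)) (σ : Γ(F, U)) (P : ComplexPoints X) (h : P.pt ∈ U),
      α U (f • σ) P = P.eval U h f • α U σ P)
    (hres : ∀ (U W : X.left.Opens) (hWU : W ≤ U) (σ : Γ(F, U)) (P : ComplexPoints X), P.pt ∈ W →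
      α W (F.presheaf.map (homOfLE hWU).op σ) P = α U σ P)
    (hcont : ∀ (U : X.left.Opens) (σ : Γ(F, U)),
      ContinuousOn (fun P ↦ (⟨P, α U σ P⟩ : TotalSpace E.F E.E)) {P | P.pt ∈ U})
    (hframe : ∀ (U : X.left.Opens) (t : Fin r → Γ(F, U)), IsSectionFrame F U t →
      ∀ P : ComplexPoints X, P.pt ∈ U → LinearIndependent ℂ (fun j ↦ α U (t j) P) ∧
        ⊤ ≤ Submodule.span ℂ (Set.range fun j ↦ α U (t j) P)) (i : ℕ) :
    theChernClassTheory.chernClassIn ℂ E i ∈ algebraicClasses X i := by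
  -- over an empty `X` there is nothing to prove
  rcases isEmpty_or_nonempty X.left with hX0 | ⟨⟨x₀⟩⟩
  · haveI : IsEmpty (ComplexPoints X) := ⟨fun P ↦ hX0.elim P.pt⟩
    haveI := ModuleCat.subsingleton_of_isZero (isZero_singularCohomology_of_isEmpty' ℂ (ComplexPoints X) (2 * i))
    rw [Subsingleton.elim (theChernClassTheory.chernClassIn ℂ E i) 0]
    exact Submodule.zero_mem _
  induction hflag generalizing r E i with
  | of_isZero F hF0 =>
    -- compare with the rank-`0` datum of the zero module (K1b)
    obtain ⟨r', E', α', hr', hrank', hF', hadd', hsmul', hres', hcont', hframe'⟩ :=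
      exists_topologicalAnalytification_of_hasRankLE hX (hasRankLE_zero_of_isZero hF0)
    obtain ⟨U, s, hxU, hs⟩ := hF x₀
    obtain ⟨U', s', hxU', hs'⟩ := hF' x₀
    obtain rfl : r = r' := frame_card_eq hs hs' hxU hxU'
    rcases Nat.eq_zero_or_pos i with rfl | hi
    · rw [theChernClassTheory.chernClassIn_zero]
      change _ ∈ supportedClasses X (2 * 0) 0
      rw [supportedClasses_zero]
      exact Submodule.mem_top
    · rw [chernClassIn_eq_of_comparison hX ℂ hF E E' α α' hadd hsmul hres hcont hframe hadd' hsmul' hres' hcont'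
        hframe' i, theChernClassTheory.chernClassIn_eq_zero_of_rank_lt ℂ E' (by omega)]
      exact Submodule.zero_mem _
  | of_shortExact S hS h₁ h₃ ih =>
    have hV₁ : IsVectorBundle S.X₁ := h₁.isFiniteLocallyFree.isVectorBundle
    obtain ⟨r₁, E₁, α₁, -, hF₁, hadd₁, hsmul₁, hres₁, hcont₁, hframe₁⟩ :=
      exists_topologicalAnalytification_of_isVectorBundle hX hV₁
    obtain ⟨r₃, E₃, α₃, hr₃, hrank₃, hF₃, hadd₃, hsmul₃, hres₃, hcont₃, hframe₃⟩ :=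
      exists_topologicalAnalytification_of_hasRankLE hX h₃
    rw [chernClassIn_eq_sum_of_comparison_shortExact hX ℂ hS h₁.isFiniteLocallyFree h₃.isFiniteLocallyFree hF₁ hF hF₃
      E₁ E E₃ α₁ α α₃ hadd₁ hsmul₁ hres₁ hcont₁ hframe₁ hadd hsmul hres hcont hframe hadd₃ hsmul₃ hres₃ hcont₃
      hframe₃ i]
    obtain ⟨U₃, t₃, hxU₃, ht₃⟩ := hF₃ x₀
    refine sum_cupEven_mem_algebraicClasses_of_rank_le_one hX
      (fun j ↦ ih hF₁ E₁ α₁ hadd₁ hsmul₁ hres₁ hcont₁ hframe₁ j)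
      (theChernClassTheory.chernClassIn_zero ℂ E₃)
      (chernClassIn_complex_one_mem_algebraicClasses_of_comparison hX E₃ α₃ hcont₃ hframe₃ ⟨x₀, hxU₃⟩ ht₃)
      (fun j hj ↦ theChernClassTheory.chernClassIn_eq_zero_of_rank_lt ℂ E₃ (by omega)) i

end Summit.HodgeConjecture.HodgeConjecture.Theorems

end
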